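import Summits.QuantumFields.YangMills.Theorems.UnitScaleTiltHalvingHSiteH42WindowLetters
import HarnessLib

/-!
# `hP1room` PROGRAMME (LEAD-H g6 «WINDOWS-6», part II of II): ★★ THE NEW `H42`-TOP WINDOWS OF THE v2 COMPOSERS (design (D2)) FROM ONE CUBIC SMALLNESS — `hkb hbudget42 hr42
# hr2 hwin42` of ✓`HalvingHSiteRowsOfSocketsT.siteRows_of_socketsT` (k ≥ 2, ★★`h42Windows_step_of_hw`) and `hα₂ hkb hbudget42 hr hr2 hwin` of
# ✓`HalvingHSiteRowsOfSocketsBaseT.siteRows_of_sockets_baseT` (k = 1, ★★`h42Windows_base_of_hw`), each followed by the knit-gauge row `hε₁l`, in the schedule letters of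
# ✓`HalvingHSupURhoWindowsRho3.exists_topCall_constants_of_rhoWindow₃` (`α₂ := 2(L·c⋆) + 8α₄`, read radius `e^{2α₄}((e^{c₁} − 1) + α₄L^{−k})` with `c₁ := c⋆L^{−(k−1)}`
# (k ≥ 2) ∕ `c₁ := 2s` (k = 1), top-log `t ∕ ttop := 2·((d·(M′+ρ′)) : ℕ)·ε₁`, member letters `4 < Cr`, `Cr·ε₁ ≤ ε₀`)

Route `UnitScaleTilt`, crux K1 child «MinimiserStabilityRegPr» (stmt-QuantumFields-19200), registered stub `stub_halvingStep` (`BirthV10`); cell `ym3-torus` (HUMAN RULING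
D-0037: YM₃ on T³ is ladder rung R3 — NOT d = 4, NOT a mass gap, NOT the Clay problem), twin-width seat `ym-ust-19936-w8` gen 4.  `--supports stmt-QuantumFields-19200
--as helper`; THEOREMS ONLY (0 `def`, 0 `sorry`); count-neutral; nothing here claims `core′`, `hMember(L)`, `hSockets`, the stub, the crux or the gap.

WHAT.  Hypotheses (all at the packs' call sites): `d = 3`, `2 ≤ L`, `2 ≤ k` (step) ∕ `k = 1` (base; the packs pass `K − n` and `h2 ∕ hKn`), the schedule's DEFINING
EQUATIONS ((0) of ✓`exists_topCall_constants_of_rhoWindow₃` with `α₀ := ε₀`; = the packs' `e0 ∕ hα₁def ∕ hcB2 ∕ eB ∕ hα₄B2`), the socket signs, the member letters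
`4 < Cr`, `0 ≤ ε₁`, `Cr·ε₁ ≤ ε₀`, and ONE cubic smallness in the (K-final) `hw` product shape
`10²⁹·L¹²·(1+B₀+B₀⁻¹)²·((1+B₀'H)(1+B₂')(1+BG)(1+BR))⁵·Z·((ρ′+M′+1)³ε₀) ≤ 1`: at the BASE `Z := 1 + cB9⁻¹` — the (K-final) `hw` VERBATIM — together with `s`'s
definition `hsdef` and `1 ≤ M′` (both displayed by the composer ∕ pack); at the STEP `Z := 1 + B₀'H⁻¹` (the read-radius window `hr2` genuinely needs it: it is
`c⋆ ≤ 16·B₀'` in disguise and `B₀' ≥ 300·L·B₀'H` is the only floor the schedule gives; a pack holding the product with both factors derives each by dropping a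
factor `≥ 1`).  Conclusions = the composers' binders VERBATIM (letters `d L k` for `(F.P K).d (F.P K).L (K − n)`; `K − n − 1` is `k − 1`) at
`t ∕ ttop := 2·((d·(M′+ρ′) : ℕ) : ℝ)·ε₁`, followed by `hε₁l : 2·((d·(M′+ρ′) : ℕ) : ℝ)·ε₁ ≤ 1`, in the order printed in each docstring (a consumer scratch
instantiating both at `(F.P K).d (F.P K).L (K − n)` with the pack letters elaborates, rc 0).  Proof: part I ★`windowLetters_of_hw` for everything but the two
read-radius windows; those by part I ★`readRadius_le` (`e^{2α₄}((e^{x} − 1) + v) ≤ (1+3α₄)(x + x² + v)`), `c₁² ≤ 2α₄L^{−k}` (step, from `c⋆ ≤ 16B₀'`, `k ≥ 2`) ∕ `4s ≤ 405s′ ≤ c⋆` (base, `1 ≤ M′`).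
Arithmetic only ([folklore]).
HONEST SCOPE.  Window bookkeeping; nothing of [Balaban1985RegularSpaces] Prop. 5 ∕ Sect. E ∕ Theorem 4, `core′` or the stub is proved here.

References: T. Bałaban, CMP **99** (1985) 75–102 [Balaban1985RegularSpaces] (Prop. 3 (1.36)–(1.42) pp.82–83, Thm 4 p.88, Prop. 5 (1.106) p.94); CMP **98** (1985) 17–51
[Balaban1985Averaging] ((54) p.26, (127)–(135) p.39, (203)–(214) pp.49–50).
-/

set_option autoImplicit false

noncomputable section

namespace Summit.QuantumFields.YangMills.Theorems.HalvingHSiteH42WindowsOfHw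

open Literature.MathematicalPhysics.QuantumFieldTheory.Balaban1983to89
open B7Prop4Flat (C2 c4)
open HalvingHSiteH42WindowLetters (readRadius_le windowLetters_of_hw)

/-! ## §1 The step (k ≥ 2): the five `H42`-top windows of `siteRows_of_socketsT` and `hε₁l` -/

set_option maxHeartbeats 400000 in
/-- ★★ **THE FIVE `H42`-TOP WINDOWS OF `siteRows_of_socketsT` (k ≥ 2, design (D2)) FROM ONE CUBIC SMALLNESS** (`Z := 1 + B₀'H⁻¹`): conclusion = the binders
`hkb hbudget42 hr42 hr2 hwin42` of ✓`HalvingHSiteRowsOfSocketsT.siteRows_of_socketsT` VERBATIM (letters `d L k` for `(F.P K).d (F.P K).L (K − n)`; `K − n − 1` is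
`k − 1`; `ttop := 2·((d·(M′+ρ′) : ℕ) : ℝ)·ε₁`), then the knit-gauge row `hε₁l : 2·((d·(M′+ρ′) : ℕ) : ℝ)·ε₁ ≤ 1` — in this order.
[cite: Balaban1985RegularSpaces, Prop. 3 (1.36)-(1.42) pp.82-83, Thm 4 p.88; Balaban1985Averaging, (54) p.26, (127)-(135) p.39, (203)-(214) pp.49-50] -/
theorem h42Windows_step_of_hw (d L : ℕ) (hd : d = 3) (hL : 2 ≤ L) {k : ℕ} (hk : 2 ≤ k) (M' ρ' : ℕ) {m₀ : ℕ}
    {ε₀ ε₁ Cr B₀ B₀'H B₂' BG BR α₁ cstar B₀' α₄ : ℝ}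
    (hε₀ : 0 < ε₀) (hB₀ : 0 < B₀) (hB₀'H : 0 < B₀'H) (hB₂' : 0 ≤ B₂') (hBG : 0 ≤ BG) (hBR : 0 ≤ BR)
    -- the schedule's defining equations ((0) of ✓`exists_topCall_constants_of_rhoWindow₃`, `α₀ := ε₀`)
    (hm₀ : m₀ = 3 * (M' + ρ') + 1)
    (hα₁ : α₁ = 198 * (((ρ' : ℝ) + M' + 1) * ε₀) + 27 * (((ρ' : ℝ) + M' + 1) * ε₀) / ((L : ℝ) * B₀))
    (hcs : cstar = 5 * (d : ℝ) * L * B₀ * (ε₀ + α₁))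
    (hB₀' : B₀' = 300 * (L : ℝ) * m₀ * (B₀'H + 15 * (L : ℝ) ^ 2 * BG * BR + 3 * BG * BR * B₂'))
    (hα₄ : α₄ = 8 * B₀' * (5 * (d : ℝ) * L * B₀) * (ε₀ + α₁))
    -- the member letters
    (hCr : 4 < Cr) (hε₁ : 0 ≤ ε₁) (hCrε : Cr * ε₁ ≤ ε₀)
    -- ONE cubic smallness (the (K-final) `hw` product shape with `(1 + B₀'H⁻¹)` in place of `(1 + cB9⁻¹)`)
    (hw : (10 : ℝ) ^ 29 * (L : ℝ) ^ 12 * (1 + B₀ + B₀⁻¹) ^ 2 * ((1 + B₀'H) * (1 + B₂') * (1 + BG) * (1 + BR)) ^ 5 * (1 + B₀'H⁻¹) *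
      (((ρ' : ℝ) + M' + 1) ^ 3 * ε₀) ≤ 1) :
    (2 * (L * cstar) + 8 * α₄) ≤ c4 d ∧
    243200 * ((((d + 2) * L : ℕ) : ℝ)) ^ 2 * (2 * (L * cstar) + 8 * α₄) ≤ 1 ∧
    Real.exp (2 * α₄) * ((Real.exp (cstar * (((L : ℝ)) ^ (k - 1))⁻¹) - 1) + α₄ * (((L : ℝ)) ^ k)⁻¹) ≤ 1 / 2 ∧
    2 * (Real.exp (2 * α₄) * ((Real.exp (cstar * (((L : ℝ)) ^ (k - 1))⁻¹) - 1) + α₄ * (((L : ℝ)) ^ k)⁻¹)) ≤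
      (2 * (L * cstar) + 8 * α₄) * (((L : ℝ)) ^ k)⁻¹ ∧
    2 * ((((d * (M' + ρ')) : ℕ)) : ℝ) * ε₁ + (C2 d + 64 * 60800 * ((((d + 2) * L : ℕ) : ℝ)) ^ 2) * (2 * (L * cstar) + 8 * α₄) ^ 2 <
      2 * (d : ℝ) * L * α₁ ∧
    2 * ((((d * (M' + ρ')) : ℕ)) : ℝ) * ε₁ ≤ 1 := by
  subst hd
  have hHi : 0 < B₀'H⁻¹ := inv_pos.2 hB₀'H
  obtain ⟨hcs0, hα₄0, hα₄', hB₀'L, -, hcsS, hℓcsS, hα₄S, hcsZ, hkb, hbud, hwin, hε₁l⟩ :=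
    windowLetters_of_hw L hL M' ρ' hε₀ hB₀ hB₀'H hB₂' hBG hBR (by linarith only [hHi.le] : (1 : ℝ) ≤ 1 + B₀'H⁻¹)
      hm₀ hα₁ hcs hB₀' hα₄ hCr hε₁ hCrε hw
  refine ⟨hkb, hbud, ?_, ?_, hwin, hε₁l⟩
  all_goals
    obtain ⟨ℓ, hℓ⟩ : ∃ ℓ : ℝ, ℓ = (L : ℝ) := ⟨_, rfl⟩
    rw [← hℓ] at hB₀'L hℓcsS ⊢
    have hℓ2 : (2 : ℝ) ≤ ℓ := by rw [hℓ]; exact_mod_cast hL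
    have hℓ1 : (1 : ℝ) ≤ ℓ := by linarith only [hℓ2]
    have hℓ0 : (0 : ℝ) < ℓ := by linarith only [hℓ2]
    have hℓne : ℓ ≠ 0 := hℓ0.ne'
    have hHne : B₀'H ≠ 0 := hB₀'H.ne'
    have hik : (ℓ ^ k)⁻¹ ≤ 1 := inv_le_one_of_one_le₀ (one_le_pow₀ hℓ1)
    have hik1 : (ℓ ^ (k - 1))⁻¹ ≤ 1 := inv_le_one_of_one_le₀ (one_le_pow₀ hℓ1)
    have hLk0 : 0 < ℓ ^ k := pow_pos hℓ0 k
    have hLk1 : 0 < ℓ ^ (k - 1) := pow_pos hℓ0 _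
    obtain ⟨c₁, hc₁⟩ : ∃ c₁ : ℝ, c₁ = cstar * (ℓ ^ (k - 1))⁻¹ := ⟨_, rfl⟩
    obtain ⟨v, hv⟩ : ∃ v : ℝ, v = α₄ * (ℓ ^ k)⁻¹ := ⟨_, rfl⟩
    rw [← hc₁, ← hv]
    have hc₁0 : 0 ≤ c₁ := by rw [hc₁]; positivity
    have hc₁cs : c₁ ≤ cstar := by
      rw [hc₁]
      calc cstar * (ℓ ^ (k - 1))⁻¹ ≤ cstar * 1 := mul_le_mul_of_nonneg_left hik1 hcs0
        _ = cstar := mul_one _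
    have hc₁S : c₁ ≤ 1 / 10 ^ 20 := hc₁cs.trans hcsS
    have hc₁1 : c₁ ≤ 1 := hc₁S.trans (by norm_num)
    have hv0' : 0 ≤ v := by rw [hv]; positivity
    have hvα : v ≤ α₄ := by
      rw [hv]
      calc α₄ * (ℓ ^ k)⁻¹ ≤ α₄ * 1 := mul_le_mul_of_nonneg_left hik hα₄0
        _ = α₄ := mul_one _
    have hvS : v ≤ 1 / 10 ^ 20 := hvα.trans hα₄S
    have hsum0 : 0 ≤ c₁ + c₁ ^ 2 + v := by positivity
    have hR : Real.exp (2 * α₄) * ((Real.exp c₁ - 1) + v) ≤ (1 + 3 * α₄) * (c₁ + c₁ ^ 2 + v) :=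
      readRadius_le hc₁0 hc₁1 hα₄0 (hα₄S.trans (by norm_num)) hv0'
  · -- `hr42`
    refine hR.trans ?_
    have hc₁sq1 : c₁ ^ 2 ≤ c₁ := by
      calc c₁ ^ 2 = c₁ * c₁ := sq c₁
        _ ≤ 1 * c₁ := mul_le_mul_of_nonneg_right hc₁1 hc₁0
        _ = c₁ := one_mul _
    have h1 : 1 + 3 * α₄ ≤ 2 := by linarith only [hα₄S]
    have h2 : c₁ + c₁ ^ 2 + v ≤ 1 / 4 := by linarith only [hc₁sq1, hc₁S, hvS]
    calc (1 + 3 * α₄) * (c₁ + c₁ ^ 2 + v) ≤ 2 * (1 / 4) := mul_le_mul h1 h2 hsum0 (by norm_num)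
      _ = 1 / 2 := by norm_num
  · -- `hr2`: `ℓ·c⋆·ℓ^{−k} = c₁`, the right side is `2c₁ + 8v`; the key smallness `c⋆ ≤ 16 B₀'` gives `c₁² ≤ 2v`
    have hk' : k = (k - 1) + 1 := by omega
    have hpow : (ℓ ^ k)⁻¹ = (ℓ ^ (k - 1))⁻¹ * ℓ⁻¹ := by
      conv_lhs => rw [hk', pow_succ]
      rw [mul_inv]
    have hℓc : ℓ * cstar * (ℓ ^ k)⁻¹ = c₁ := by
      rw [hc₁, hpow, show ℓ * cstar * ((ℓ ^ (k - 1))⁻¹ * ℓ⁻¹) = cstar * (ℓ ^ (k - 1))⁻¹ * (ℓ * ℓ⁻¹) by ring,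
        mul_inv_cancel₀ hℓne, mul_one]
    have hrhs : (2 * (ℓ * cstar) + 8 * α₄) * (ℓ ^ k)⁻¹ = 2 * c₁ + 8 * v := by
      rw [hv, ← hℓc]; ring
    have hB₀'0 : 0 ≤ B₀' := le_trans (by positivity) hB₀'L
    have hcsB₀' : cstar ≤ 16 * B₀' := by
      -- `c⋆·B₀'H⁻¹ ≤ c⋆·Z ≤ 10⁻²⁰`, so `c⋆ ≤ 10⁻²⁰·B₀'H ≤ 300·ℓ·B₀'H ≤ B₀'`
      have h1 : cstar * B₀'H⁻¹ ≤ cstar * (1 + B₀'H⁻¹) := mul_le_mul_of_nonneg_left (by linarith only) hcs0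
      have h2 : cstar * B₀'H⁻¹ ≤ 1 / 10 ^ 20 := h1.trans hcsZ
      have h3 : cstar = cstar * B₀'H⁻¹ * B₀'H := by rw [mul_assoc, inv_mul_cancel₀ hHne, mul_one]
      have h4 : cstar * B₀'H⁻¹ * B₀'H ≤ 1 / 10 ^ 20 * B₀'H := mul_le_mul_of_nonneg_right h2 hB₀'H.le
      have h5 : 1 / 10 ^ 20 * B₀'H ≤ 300 * ℓ * B₀'H := mul_le_mul_of_nonneg_right (by linarith only [hℓ1]) hB₀'H.le
      linarith only [h3, h4, h5, hB₀'L, hB₀'0]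
    have hc₁sq : c₁ ^ 2 ≤ 2 * v := by
      have hi0 : 0 ≤ (ℓ ^ (k - 1))⁻¹ := by positivity
      have hkm : 1 ≤ k - 1 := by omega
      have hi2 : (ℓ ^ (k - 1))⁻¹ ≤ ℓ⁻¹ := by
        refine inv_anti₀ hℓ0 ?_
        calc ℓ = ℓ ^ 1 := (pow_one ℓ).symm
          _ ≤ ℓ ^ (k - 1) := pow_le_pow_right₀ hℓ1 hkm
      have h2 : c₁ ^ 2 = cstar * cstar * ((ℓ ^ (k - 1))⁻¹ * (ℓ ^ (k - 1))⁻¹) := by rw [hc₁]; ring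
      have h3 : cstar * cstar ≤ 16 * B₀' * cstar := mul_le_mul_of_nonneg_right hcsB₀' hcs0
      have h4 : (ℓ ^ (k - 1))⁻¹ * (ℓ ^ (k - 1))⁻¹ ≤ (ℓ ^ (k - 1))⁻¹ * ℓ⁻¹ := mul_le_mul_of_nonneg_left hi2 hi0
      have h5 : c₁ ^ 2 ≤ 16 * B₀' * cstar * ((ℓ ^ (k - 1))⁻¹ * ℓ⁻¹) := by
        rw [h2]
        exact mul_le_mul h3 h4 (by positivity) (by positivity)
      have h6 : 2 * v = 16 * B₀' * cstar * ((ℓ ^ (k - 1))⁻¹ * ℓ⁻¹) := by rw [hv, hα₄', hpow]; ring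
      linarith only [h5, h6]
    have hα₄c₁ : α₄ * c₁ = (ℓ * cstar) * v := by rw [hv, ← hℓc]; ring
    rw [hrhs]
    have h1 : 2 * (Real.exp (2 * α₄) * ((Real.exp c₁ - 1) + v)) ≤ 2 * ((1 + 3 * α₄) * (c₁ + c₁ ^ 2 + v)) := by linarith only [hR]
    refine h1.trans ?_
    have hB : α₄ * c₁ ≤ 1 / 24 * v := by
      rw [hα₄c₁]
      exact mul_le_mul_of_nonneg_right (hℓcsS.trans (by norm_num)) hv0'
    have hC : α₄ * c₁ ^ 2 ≤ 1 / 12 * v := by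
      have h2 : α₄ * c₁ ^ 2 ≤ α₄ * (2 * v) := mul_le_mul_of_nonneg_left hc₁sq hα₄0
      have h3 : α₄ * (2 * v) ≤ 1 / 24 * (2 * v) := mul_le_mul_of_nonneg_right (hα₄S.trans (by norm_num)) (by positivity)
      linarith only [h2, h3]
    have hD : α₄ * v ≤ 1 / 24 * v := mul_le_mul_of_nonneg_right (hα₄S.trans (by norm_num)) hv0'
    have e : 2 * ((1 + 3 * α₄) * (c₁ + c₁ ^ 2 + v)) = 2 * c₁ + 2 * c₁ ^ 2 + 2 * v + 6 * (α₄ * c₁) + 6 * (α₄ * c₁ ^ 2) + 6 * (α₄ * v) := by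
      ring
    rw [e]; linarith only [hc₁sq, hB, hC, hD, hv0']

/-! ## §2 The base (k = 1): the `H42`-top windows of `siteRows_of_sockets_baseT` and `hε₁l` -/

set_option maxHeartbeats 400000 in
/-- ★★ **THE `H42`-TOP WINDOWS OF `siteRows_of_sockets_baseT` (k = 1, design (D2)) FROM THE (K-final) CUBIC SMALLNESS VERBATIM** (`Z := 1 + cB9⁻¹`; read letter
`c₁ := 2s`, `s := (198 + 12((M′−1)+4ρ′))ε₀` = `hsdef`, `1 ≤ M′`): conclusion = the binders `hα₂ hkb hbudget42 hr hr2 hwin` of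
✓`HalvingHSiteRowsOfSocketsBaseT.siteRows_of_sockets_baseT` VERBATIM (letters `d L k` for `(F.P K).d (F.P K).L (K − n)` with `k = 1`; `t := 2·((d·(M′+ρ′) : ℕ) : ℝ)·ε₁`),
then the knit-gauge row `hε₁l : 2·((d·(M′+ρ′) : ℕ) : ℝ)·ε₁ ≤ 1` — in this order.
[cite: Balaban1985RegularSpaces, Prop. 3 (1.36)-(1.42) pp.82-83, Thm 4 p.88; Balaban1985Averaging, (54) p.26, (127)-(135) p.39, (203)-(214) pp.49-50] -/
theorem h42Windows_base_of_hw (d L : ℕ) (hd : d = 3) (hL : 2 ≤ L) {k : ℕ} (hk : k = 1) (M' ρ' : ℕ) (hM' : 1 ≤ M') {m₀ : ℕ}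
    {ε₀ ε₁ Cr B₀ B₀'H B₂' BG BR cB9 α₁ cstar B₀' α₄ s : ℝ}
    (hε₀ : 0 < ε₀) (hB₀ : 0 < B₀) (hB₀'H : 0 < B₀'H) (hB₂' : 0 ≤ B₂') (hBG : 0 ≤ BG) (hBR : 0 ≤ BR) (hcB9 : 0 < cB9)
    (hsdef : s = (198 + 12 * (((M' : ℝ) - 1) + 4 * ρ')) * ε₀)
    -- the schedule's defining equations ((0) of ✓`exists_topCall_constants_of_rhoWindow₃`, `α₀ := ε₀`)
    (hm₀ : m₀ = 3 * (M' + ρ') + 1)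
    (hα₁ : α₁ = 198 * (((ρ' : ℝ) + M' + 1) * ε₀) + 27 * (((ρ' : ℝ) + M' + 1) * ε₀) / ((L : ℝ) * B₀))
    (hcs : cstar = 5 * (d : ℝ) * L * B₀ * (ε₀ + α₁))
    (hB₀' : B₀' = 300 * (L : ℝ) * m₀ * (B₀'H + 15 * (L : ℝ) ^ 2 * BG * BR + 3 * BG * BR * B₂'))
    (hα₄ : α₄ = 8 * B₀' * (5 * (d : ℝ) * L * B₀) * (ε₀ + α₁))
    -- the member letters
    (hCr : 4 < Cr) (hε₁ : 0 ≤ ε₁) (hCrε : Cr * ε₁ ≤ ε₀)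
    -- the (K-final) cubic smallness VERBATIM
    (hw : (10 : ℝ) ^ 29 * (L : ℝ) ^ 12 * (1 + B₀ + B₀⁻¹) ^ 2 * ((1 + B₀'H) * (1 + B₂') * (1 + BG) * (1 + BR)) ^ 5 * (1 + cB9⁻¹) *
      (((ρ' : ℝ) + M' + 1) ^ 3 * ε₀) ≤ 1) :
    0 ≤ 2 * (L * cstar) + 8 * α₄ ∧
    (2 * (L * cstar) + 8 * α₄) ≤ c4 d ∧
    243200 * ((((d + 2) * L : ℕ) : ℝ)) ^ 2 * (2 * (L * cstar) + 8 * α₄) ≤ 1 ∧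
    Real.exp (2 * α₄) * ((Real.exp (2 * s) - 1) + α₄ * (((L : ℝ)) ^ k)⁻¹) ≤ 1 / 2 ∧
    2 * (Real.exp (2 * α₄) * ((Real.exp (2 * s) - 1) + α₄ * (((L : ℝ)) ^ k)⁻¹)) ≤
      (2 * (L * cstar) + 8 * α₄) * (((L : ℝ)) ^ k)⁻¹ ∧
    2 * ((((d * (M' + ρ')) : ℕ)) : ℝ) * ε₁ + (C2 d + 64 * 60800 * ((((d + 2) * L : ℕ) : ℝ)) ^ 2) * (2 * (L * cstar) + 8 * α₄) ^ 2 <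
      2 * (d : ℝ) * L * α₁ ∧
    2 * ((((d * (M' + ρ')) : ℕ)) : ℝ) * ε₁ ≤ 1 := by
  subst hd hk
  have hci : 0 < cB9⁻¹ := inv_pos.2 hcB9
  obtain ⟨hcs0, hα₄0, -, -, hcsL, hcsS, hℓcsS, hα₄S, -, hkb, hbud, hwin, hε₁l⟩ :=
    windowLetters_of_hw L hL M' ρ' hε₀ hB₀ hB₀'H hB₂' hBG hBR (by linarith only [hci.le] : (1 : ℝ) ≤ 1 + cB9⁻¹)
      hm₀ hα₁ hcs hB₀' hα₄ hCr hε₁ hCrε hw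
  have hα₂0 : 0 ≤ 2 * ((L : ℝ) * cstar) + 8 * α₄ := by positivity
  refine ⟨hα₂0, hkb, hbud, ?_, ?_, hwin, hε₁l⟩
  all_goals
    obtain ⟨ℓ, hℓ⟩ : ∃ ℓ : ℝ, ℓ = (L : ℝ) := ⟨_, rfl⟩
    rw [← hℓ] at hℓcsS ⊢
    have hℓ2 : (2 : ℝ) ≤ ℓ := by rw [hℓ]; exact_mod_cast hL
    have hℓ1 : (1 : ℝ) ≤ ℓ := by linarith only [hℓ2]
    have hℓ0 : (0 : ℝ) < ℓ := by linarith only [hℓ2]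
    have hℓne : ℓ ≠ 0 := hℓ0.ne'
    have hik : (ℓ ^ 1)⁻¹ ≤ 1 := inv_le_one_of_one_le₀ (one_le_pow₀ hℓ1)
    have hLk0 : 0 < ℓ ^ 1 := pow_pos hℓ0 1
    -- `0 ≤ s`, `4s ≤ 405 s′ ≤ c⋆` (uses `1 ≤ M′`), so `s ≤ 10⁻²⁰`
    have hM1 : (1 : ℝ) ≤ M' := by exact_mod_cast hM'
    have hρ0 : (0 : ℝ) ≤ ρ' := Nat.cast_nonneg _
    have hs0 : 0 ≤ s := by
      rw [hsdef]
      have : (0 : ℝ) ≤ 198 + 12 * (((M' : ℝ) - 1) + 4 * ρ') := by linarith only [hM1, hρ0]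
      positivity
    have h4s : 4 * s ≤ cstar := by
      have e : 405 * ((((ρ' : ℝ) + M' + 1)) * ε₀) - 4 * ((198 + 12 * (((M' : ℝ) - 1) + 4 * ρ')) * ε₀)
          = 213 * ((ρ' : ℝ) * ε₀) + 357 * ((M' : ℝ) * ε₀) - 339 * ε₀ := by ring
      have hM'ε : ε₀ ≤ (M' : ℝ) * ε₀ := le_mul_of_one_le_left hε₀.le hM1
      have hρε : (0 : ℝ) ≤ (ρ' : ℝ) * ε₀ := mul_nonneg hρ0 hε₀.le
      rw [hsdef]; linarith only [e, hM'ε, hρε, hε₀.le, hcsL]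
    have hsS : s ≤ 1 / 10 ^ 20 := by linarith only [h4s, hcsS, hs0]
    have h2s1 : 2 * s ≤ 1 := by linarith only [hsS]
    obtain ⟨v, hv⟩ : ∃ v : ℝ, v = α₄ * (ℓ ^ 1)⁻¹ := ⟨_, rfl⟩
    rw [← hv]
    have hv0' : 0 ≤ v := by rw [hv]; positivity
    have hvα : v ≤ α₄ := by
      rw [hv]
      calc α₄ * (ℓ ^ 1)⁻¹ ≤ α₄ * 1 := mul_le_mul_of_nonneg_left hik hα₄0
        _ = α₄ := mul_one _
    have hvS : v ≤ 1 / 10 ^ 20 := hvα.trans hα₄S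
    have hsum0 : 0 ≤ 2 * s + (2 * s) ^ 2 + v := by positivity
    have hR : Real.exp (2 * α₄) * ((Real.exp (2 * s) - 1) + v) ≤ (1 + 3 * α₄) * (2 * s + (2 * s) ^ 2 + v) :=
      readRadius_le (by linarith only [hs0]) h2s1 hα₄0 (hα₄S.trans (by norm_num)) hv0'
    have hss : s ^ 2 ≤ 1 / 10 ^ 20 * s := by
      calc s ^ 2 = s * s := sq s
        _ ≤ 1 / 10 ^ 20 * s := mul_le_mul_of_nonneg_right hsS hs0
  · -- `hr`
    refine hR.trans ?_
    have h1 : 1 + 3 * α₄ ≤ 2 := by linarith only [hα₄S]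
    have h2 : 2 * s + (2 * s) ^ 2 + v ≤ 1 / 4 := by
      have e : (2 * s) ^ 2 = 4 * s ^ 2 := by ring
      linarith only [hss, hsS, hvS, e, hs0]
    calc (1 + 3 * α₄) * (2 * s + (2 * s) ^ 2 + v) ≤ 2 * (1 / 4) := mul_le_mul h1 h2 hsum0 (by norm_num)
      _ = 1 / 2 := by norm_num
  · -- `hr2` at `k = 1`: the right side is `2c⋆ + 8v`; `4s ≤ c⋆` carries it
    have hrhs : (2 * (ℓ * cstar) + 8 * α₄) * (ℓ ^ 1)⁻¹ = 2 * cstar + 8 * v := by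
      rw [hv, pow_one]; field_simp
    rw [hrhs]
    have h1 : 2 * (Real.exp (2 * α₄) * ((Real.exp (2 * s) - 1) + v)) ≤ 2 * ((1 + 3 * α₄) * (2 * s + (2 * s) ^ 2 + v)) := by
      linarith only [hR]
    refine h1.trans ?_
    have hB : α₄ * s ≤ 1 / 10 ^ 20 * s := mul_le_mul_of_nonneg_right hα₄S hs0
    have hC : α₄ * s ^ 2 ≤ 1 / 10 ^ 20 * s ^ 2 := mul_le_mul_of_nonneg_right hα₄S (sq_nonneg s)
    have hC' : s ^ 2 ≤ s := by linarith only [hss, hs0]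
    have hD : α₄ * v ≤ 1 / 24 * v := mul_le_mul_of_nonneg_right (hα₄S.trans (by norm_num)) hv0'
    have e : 2 * ((1 + 3 * α₄) * (2 * s + (2 * s) ^ 2 + v)) = 4 * s + 8 * s ^ 2 + 2 * v + 12 * (α₄ * s) + 24 * (α₄ * s ^ 2) + 6 * (α₄ * v) := by
      ring
    rw [e]; linarith only [h4s, hss, hB, hC, hC', hD, hv0', hs0, hcs0]

/-! ## §3 (v1.1) The same two tuples at the t-SHAPE OF RECORD `2·(X·ε₁)` (LEAD-H WORD 4 (2) = ✓`htop_of_knitGauge`'s conclusion and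
✓`htopSocket_of_member`'s `hε₁l`; review nit w2-19936 g9 21:44:56Z): the v1 lemmas print `2 * X * ε₁` (left-associated), so the v2 packs ✓p672054 ∕ ✓p672161
bridge with `simpa only [mul_assoc]`; the primed twins below print `2 * (X * ε₁)` and drop in with no shim. -/

set_option maxHeartbeats 400000 in
/-- ★★ v1.1 twin of ★★`h42Windows_step_of_hw` at the t-shape of record: identical hypotheses; conclusion `hkb ∧ hbudget42 ∧ hr42 ∧ hr2 ∧ hwin42 ∧ hε₁l` with
`ttop := 2 * ((((d * (M′ + ρ′)) : ℕ) : ℝ) * ε₁)` (right-associated, = ✓`htopSocket_of_member`'s letters).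
[cite: Balaban1985RegularSpaces, Prop. 3 (1.36)-(1.42) pp.82-83, Thm 4 p.88; Balaban1985Averaging, (54) p.26, (127)-(135) p.39, (203)-(214) pp.49-50] -/
theorem h42Windows_step_of_hw' (d L : ℕ) (hd : d = 3) (hL : 2 ≤ L) {k : ℕ} (hk : 2 ≤ k) (M' ρ' : ℕ) {m₀ : ℕ}
    {ε₀ ε₁ Cr B₀ B₀'H B₂' BG BR α₁ cstar B₀' α₄ : ℝ}
    (hε₀ : 0 < ε₀) (hB₀ : 0 < B₀) (hB₀'H : 0 < B₀'H) (hB₂' : 0 ≤ B₂') (hBG : 0 ≤ BG) (hBR : 0 ≤ BR)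
    (hm₀ : m₀ = 3 * (M' + ρ') + 1)
    (hα₁ : α₁ = 198 * (((ρ' : ℝ) + M' + 1) * ε₀) + 27 * (((ρ' : ℝ) + M' + 1) * ε₀) / ((L : ℝ) * B₀))
    (hcs : cstar = 5 * (d : ℝ) * L * B₀ * (ε₀ + α₁))
    (hB₀' : B₀' = 300 * (L : ℝ) * m₀ * (B₀'H + 15 * (L : ℝ) ^ 2 * BG * BR + 3 * BG * BR * B₂'))
    (hα₄ : α₄ = 8 * B₀' * (5 * (d : ℝ) * L * B₀) * (ε₀ + α₁))
    (hCr : 4 < Cr) (hε₁ : 0 ≤ ε₁) (hCrε : Cr * ε₁ ≤ ε₀)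
    (hw : (10 : ℝ) ^ 29 * (L : ℝ) ^ 12 * (1 + B₀ + B₀⁻¹) ^ 2 * ((1 + B₀'H) * (1 + B₂') * (1 + BG) * (1 + BR)) ^ 5 * (1 + B₀'H⁻¹) *
      (((ρ' : ℝ) + M' + 1) ^ 3 * ε₀) ≤ 1) :
    (2 * (L * cstar) + 8 * α₄) ≤ c4 d ∧
    243200 * ((((d + 2) * L : ℕ) : ℝ)) ^ 2 * (2 * (L * cstar) + 8 * α₄) ≤ 1 ∧
    Real.exp (2 * α₄) * ((Real.exp (cstar * (((L : ℝ)) ^ (k - 1))⁻¹) - 1) + α₄ * (((L : ℝ)) ^ k)⁻¹) ≤ 1 / 2 ∧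
    2 * (Real.exp (2 * α₄) * ((Real.exp (cstar * (((L : ℝ)) ^ (k - 1))⁻¹) - 1) + α₄ * (((L : ℝ)) ^ k)⁻¹)) ≤
      (2 * (L * cstar) + 8 * α₄) * (((L : ℝ)) ^ k)⁻¹ ∧
    2 * (((((d * (M' + ρ')) : ℕ)) : ℝ) * ε₁) + (C2 d + 64 * 60800 * ((((d + 2) * L : ℕ) : ℝ)) ^ 2) * (2 * (L * cstar) + 8 * α₄) ^ 2 <
      2 * (d : ℝ) * L * α₁ ∧
    2 * (((((d * (M' + ρ')) : ℕ)) : ℝ) * ε₁) ≤ 1 := by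
  obtain ⟨hkb, hbud, hr42, hr2, hwin, hε₁l⟩ :=
    h42Windows_step_of_hw d L hd hL hk M' ρ' hε₀ hB₀ hB₀'H hB₂' hBG hBR hm₀ hα₁ hcs hB₀' hα₄ hCr hε₁ hCrε hw
  refine ⟨hkb, hbud, hr42, hr2, ?_, ?_⟩
  · rw [← mul_assoc]; exact hwin
  · rw [← mul_assoc]; exact hε₁l

set_option maxHeartbeats 400000 in
/-- ★★ v1.1 twin of ★★`h42Windows_base_of_hw` at the t-shape of record: identical hypotheses; conclusion `hα₂ ∧ hkb ∧ hbudget42 ∧ hr ∧ hr2 ∧ hwin ∧ hε₁l` with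
`t := 2 * ((((d * (M′ + ρ′)) : ℕ) : ℝ) * ε₁)` (right-associated, = ✓`htopSocket_of_member`'s letters).
[cite: Balaban1985RegularSpaces, Prop. 3 (1.36)-(1.42) pp.82-83, Thm 4 p.88; Balaban1985Averaging, (54) p.26, (127)-(135) p.39, (203)-(214) pp.49-50] -/
theorem h42Windows_base_of_hw' (d L : ℕ) (hd : d = 3) (hL : 2 ≤ L) {k : ℕ} (hk : k = 1) (M' ρ' : ℕ) (hM' : 1 ≤ M') {m₀ : ℕ}
    {ε₀ ε₁ Cr B₀ B₀'H B₂' BG BR cB9 α₁ cstar B₀' α₄ s : ℝ}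
    (hε₀ : 0 < ε₀) (hB₀ : 0 < B₀) (hB₀'H : 0 < B₀'H) (hB₂' : 0 ≤ B₂') (hBG : 0 ≤ BG) (hBR : 0 ≤ BR) (hcB9 : 0 < cB9)
    (hsdef : s = (198 + 12 * (((M' : ℝ) - 1) + 4 * ρ')) * ε₀)
    (hm₀ : m₀ = 3 * (M' + ρ') + 1)
    (hα₁ : α₁ = 198 * (((ρ' : ℝ) + M' + 1) * ε₀) + 27 * (((ρ' : ℝ) + M' + 1) * ε₀) / ((L : ℝ) * B₀))
    (hcs : cstar = 5 * (d : ℝ) * L * B₀ * (ε₀ + α₁))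
    (hB₀' : B₀' = 300 * (L : ℝ) * m₀ * (B₀'H + 15 * (L : ℝ) ^ 2 * BG * BR + 3 * BG * BR * B₂'))
    (hα₄ : α₄ = 8 * B₀' * (5 * (d : ℝ) * L * B₀) * (ε₀ + α₁))
    (hCr : 4 < Cr) (hε₁ : 0 ≤ ε₁) (hCrε : Cr * ε₁ ≤ ε₀)
    (hw : (10 : ℝ) ^ 29 * (L : ℝ) ^ 12 * (1 + B₀ + B₀⁻¹) ^ 2 * ((1 + B₀'H) * (1 + B₂') * (1 + BG) * (1 + BR)) ^ 5 * (1 + cB9⁻¹) *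
      (((ρ' : ℝ) + M' + 1) ^ 3 * ε₀) ≤ 1) :
    0 ≤ 2 * (L * cstar) + 8 * α₄ ∧
    (2 * (L * cstar) + 8 * α₄) ≤ c4 d ∧
    243200 * ((((d + 2) * L : ℕ) : ℝ)) ^ 2 * (2 * (L * cstar) + 8 * α₄) ≤ 1 ∧
    Real.exp (2 * α₄) * ((Real.exp (2 * s) - 1) + α₄ * (((L : ℝ)) ^ k)⁻¹) ≤ 1 / 2 ∧
    2 * (Real.exp (2 * α₄) * ((Real.exp (2 * s) - 1) + α₄ * (((L : ℝ)) ^ k)⁻¹)) ≤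
      (2 * (L * cstar) + 8 * α₄) * (((L : ℝ)) ^ k)⁻¹ ∧
    2 * (((((d * (M' + ρ')) : ℕ)) : ℝ) * ε₁) + (C2 d + 64 * 60800 * ((((d + 2) * L : ℕ) : ℝ)) ^ 2) * (2 * (L * cstar) + 8 * α₄) ^ 2 <
      2 * (d : ℝ) * L * α₁ ∧
    2 * (((((d * (M' + ρ')) : ℕ)) : ℝ) * ε₁) ≤ 1 := by
  obtain ⟨hα₂, hkb, hbud, hr, hr2, hwin, hε₁l⟩ :=
    h42Windows_base_of_hw d L hd hL hk M' ρ' hM' hε₀ hB₀ hB₀'H hB₂' hBG hBR hcB9 hsdef hm₀ hα₁ hcs hB₀' hα₄ hCr hε₁ hCrε hw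
  refine ⟨hα₂, hkb, hbud, hr, hr2, ?_, ?_⟩
  · rw [← mul_assoc]; exact hwin
  · rw [← mul_assoc]; exact hε₁l

end Summit.QuantumFields.YangMills.Theorems.HalvingHSiteH42WindowsOfHw

end
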